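import Summits.QuantumFields.YangMills.Theorems.EquipartitionCriticalityEquipartitionPinsProbeTangentSteinCore
import Mathlib.Analysis.Calculus.MeanValue
import HarnessLib

/-!
# Crux U `FreeProbeLawG` (stmt-QuantumFields-23756), line `birth`, STUB `stub_sdRate` — part 1: abstract core estimate

Route `SteinGapBootstrap` of `QuantumFields/YangMills` (width seat `ym-line-sgb-p1-w2`; helper for the registered stub `stub_sdRate`
of the lead's skeleton `Cruxes/FreeProbeLawG/Lines/birth.lean`). HONEST LABEL: the route serves the RECORD-label rung R2ξ-G
(`WeakCouplingRates.XiPow`, an UPPER bound on the lattice gap); nothing here bears on the Yang–Mills mass gap itself.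

`SdRate.core_defect_fderiv`: the tree's `EquipartitionPinsProbe.TangentSteinFiniteBeta.core_defect` (crux 8760, STUB TS7;
trigonometric tests `Fn(∑ h·Y)` of ONE linear statistic) generalised to bounded `C¹` tests `g(Y_S)` of the whole block
`Y_S = (Y_p^a)_{p ∈ S, a}` with `‖∇g‖ ≤ M` (sup norm of the Pi type). On a compact state space with a probability measure `μ` and a
jointly continuous flow `T_t`: if the coordinates `Y_p^a` have flow-derivative `√β(σ δ_{ab} dδ_p + err)`, `err² ≤ K W_p` (`W ≥ 0`),
the "action" `Se` has flow-derivative `D` with `|√β D − σ ∑_{q∈Pe} dδ_q Y_q^b| ≤ K√β ∑_{q∈Pe} W_q`, and the skew shift identity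
`∫ g(Y_S ∘ T_t) dμ = ∫ g(Y_S) e^{−β(Se∘T_{−t} − Se)} dμ` holds, then for every `θ > 0`
`|∑_{p∈S} dδ_p ∫ ∂_{(p,b)} g(Y_S) dμ − ∫ g(Y_S) (∑_{p∈S} dδ_p Y_p^b) dμ| ≤ M (θ/2 + K ∫∑_{p∈S} W_p dμ /(2θ)) + K√β ∫ ∑_{q∈Pe} W_q dμ`:
differentiate the shift identity at `t = 0` under the integral sign (tree `stub_diffIdentity`; chain rule through `fderiv`,
Lipschitz constants from the flow property, the mean value inequality for `g`, compactness), split `∇g · V`,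
`V = √β(σ ∑_p dδ_p e_{(p,b)} + Err)`, by linearity and bound `|∇g · Err| ≤ M ‖Err‖_∞ ≤ M(θ/2 + K ∑_p W_p/(2θ))` (AM–GM).
Adapted from `Theorems/EquipartitionCriticalityEquipartitionPinsProbeTangentSteinCore.lean`. Reference: S. Chatterjee,
arXiv:1602.01222 §11 (Stein/Schwinger–Dyson for lattice gauge theory). [arXiv160201222]
-/

set_option autoImplicit false

noncomputable section

open MeasureTheory Filter Topology
open Summit.QuantumFields.YangMills.Theorems.EquipartitionPinsProbe
open Summit.QuantumFields.YangMills.Theorems.EquipartitionPinsProbe.TangentSteinFiniteBeta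

namespace Summit.QuantumFields.YangMills.Cruxes.FreeProbeLawG.SteinFree
namespace SdRate

section Core

variable {X : Type} [TopologicalSpace X] [CompactSpace X] [MeasurableSpace X] [OpensMeasurableSpace X]

/-- `|ℓ v| ≤ M ‖v‖` for a continuous linear functional of operator norm `≤ M`. -/
theorem abs_clm_apply_le {E : Type*} [NormedAddCommGroup E] [NormedSpace ℝ E] (L : E →L[ℝ] ℝ) {M : ℝ}
    (hL : ‖L‖ ≤ M) (v : E) : |L v| ≤ M * ‖v‖ := by
  rw [← Real.norm_eq_abs]
  exact (L.le_opNorm v).trans (mul_le_mul_of_nonneg_right hL (norm_nonneg _))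

/-- A `C¹` map with `‖∇g‖ ≤ M` everywhere is `M`-Lipschitz: `|g y − g y'| ≤ M ‖y − y'‖` (mean value inequality). -/
theorem abs_sub_le_of_fderiv_le {E : Type*} [NormedAddCommGroup E] [NormedSpace ℝ E] {g : E → ℝ} {M : ℝ} (hM : 0 ≤ M)
    (hg : ContDiff ℝ 1 g) (hgM : ∀ y, ‖fderiv ℝ g y‖ ≤ M) (y y' : E) : |g y - g y'| ≤ M * ‖y - y'‖ := by
  have hlip : LipschitzWith ⟨M, hM⟩ g :=
    lipschitzWith_of_nnnorm_fderiv_le (hg.differentiable one_ne_zero) fun x => by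
      rw [← NNReal.coe_le_coe, coe_nnnorm]; exact hgM x
  have h := hlip.dist_le_mul y y'
  rwa [Real.dist_eq, dist_eq_norm] at h

/-- **Core estimate for `C¹` tests of the block field (abstract form).** See the module docstring. The test observable is
`U ↦ g (Y_S U)`, `Y_S U = fun (q : S) a => Y U q a`, with `g` of class `C¹`, `|g| ≤ 1`, `‖fderiv g‖ ≤ M`; the first term pairs
`dδ` with the partial derivatives `∂_{(p,b)} g = fderiv g (Y_S U) e_{(p,b)}`, `e_{(p,b)} = fun q a => [q = p ∧ a = b]`. -/
theorem core_defect_fderiv (μ : Measure X) [IsProbabilityMeasure μ] {β : ℝ} (hβ : 0 < β)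
    {ι : Type} [DecidableEq ι] (S Pe : Finset ι) (hPS : Pe ⊆ S) {Dc : ℕ} (b : Fin Dc)
    (dδ : ι → ℝ) (hδ0 : ∀ p ∈ S, p ∉ Pe → dδ p = 0) {Cδ : ℝ} (hCδ0 : 0 ≤ Cδ) (hCδ : ∀ p, |dδ p| ≤ Cδ)
    (σ : ℝ) (hσ : σ = 1 ∨ σ = -1)
    (T : ℝ → X → X) (hT0 : ∀ U, T 0 U = U) (hflow : ∀ s t U, T (t + s) U = T t (T s U))
    (hTc : Continuous fun q : ℝ × X => T q.1 q.2)
    (Y : X → ι → Fin Dc → ℝ) (hYc : ∀ p a, Continuous fun U => Y U p a)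
    (W : X → ι → ℝ) (hWc : ∀ p, Continuous fun U => W U p) (hW0 : ∀ U p, 0 ≤ W U p)
    (Se : X → ℝ) (hSec : Continuous Se)
    (ℓ : X → ℝ) (hℓ : ∀ U, ℓ U = ∑ p ∈ S, dδ p * Y U p b)
    (K : ℝ) (hK : 0 ≤ K)
    (hY : ∀ (U : X) (p : ι) (a : Fin Dc), ∃ err : ℝ,
      HasDerivAt (fun t => Y (T t U) p a) (Real.sqrt β * (σ * (if a = b then dδ p else 0) + err)) 0 ∧
      err ^ 2 ≤ K * W U p)
    (hD : ∀ U : X, ∃ D : ℝ, HasDerivAt (fun t => Se (T t U)) D 0 ∧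
      |Real.sqrt β * D - σ * ∑ q ∈ Pe, dδ q * Y U q b| ≤ K * Real.sqrt β * ∑ q ∈ Pe, W U q)
    (g : (↥S → Fin Dc → ℝ) → ℝ) {M : ℝ} (hM : 0 ≤ M) (hg : ContDiff ℝ 1 g)
    (hgb : ∀ y, |g y| ≤ 1) (hgM : ∀ y, ‖fderiv ℝ g y‖ ≤ M)
    (hHaar : ∀ t : ℝ, ∫ U, g (fun q a => Y (T t U) q a) ∂μ =
      ∫ U, g (fun q a => Y U q a) * Real.exp (-(β * (Se (T (-t) U) - Se U))) ∂μ)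
    {θ : ℝ} (hθ : 0 < θ) :
    |(∑ p : ↥S, dδ p * ∫ U, fderiv ℝ g (fun q a => Y U q a) (fun q a => if q = p ∧ a = b then (1 : ℝ) else 0) ∂μ) -
        ∫ U, g (fun q a => Y U q a) * ℓ U ∂μ| ≤
      M * (θ / 2 + K * (∫ U, ∑ p ∈ S, W U p ∂μ) / (2 * θ)) + K * Real.sqrt β * ∫ U, ∑ q ∈ Pe, W U q ∂μ := by
  classical
  have hsβ : 0 < Real.sqrt β := Real.sqrt_pos.2 hβ
  have hσabs : |σ| = 1 := by rcases hσ with rfl | rfl <;> simp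
  -- the block field and its basis vectors
  set YS : X → (↥S → Fin Dc → ℝ) := fun U q a => Y U q a with hYS
  set E : ↥S → (↥S → Fin Dc → ℝ) := fun p q a => if q = p ∧ a = b then (1 : ℝ) else 0 with hE
  have hYSc : Continuous YS := continuous_pi fun q => continuous_pi fun a => hYc q a
  have hYSTc : Continuous fun z : ℝ × X => YS (T z.1 z.2) := hYSc.comp hTc
  have hgc : Continuous g := hg.continuous
  have hfdc : Continuous (fderiv ℝ g) := hg.continuous_fderiv one_ne_zero
  have hℓc : Continuous ℓ := by
    have : ℓ = fun U => ∑ p ∈ S, dδ p * Y U p b := funext hℓ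
    rw [this]
    exact continuous_finsetSum _ fun p _ => continuous_const.mul (hYc p b)
  obtain ⟨CS, -, hCS⟩ := exists_abs_le_of_continuous hSec
  have hTt : ∀ t, Continuous fun U => T t U := continuous_slice T hTc
  -- uniform bounds (compactness)
  choose CW hCW0 hCW using fun p => exists_abs_le_of_continuous (hWc p)
  choose CY hCY0 hCY using fun p => exists_abs_le_of_continuous (hYc p b)
  -- the derivative data
  choose err herr using hY
  choose D hDer using hD
  -- the velocity of the block field and the error block
  set VS : X → (↥S → Fin Dc → ℝ) := fun U q a =>
    Real.sqrt β * (σ * (if a = b then dδ q else 0) + err U q a) with hVS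
  set ErrS : X → (↥S → Fin Dc → ℝ) := fun U q a => err U q a with hErrS
  -- bound on the field derivative
  have herrb : ∀ U p a, |err U p a| ≤ Real.sqrt (K * CW p) := fun U p a => by
    refine Real.abs_le_sqrt ((herr U p a).2.trans ?_)
    exact mul_le_mul_of_nonneg_left ((le_abs_self _).trans (hCW p U)) hK
  set LV : ℝ := Real.sqrt β * (Cδ + ∑ p ∈ S, Real.sqrt (K * CW p)) with hLV
  have hsum0 : 0 ≤ ∑ p ∈ S, Real.sqrt (K * CW p) := Finset.sum_nonneg fun p _ => Real.sqrt_nonneg _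
  have hLV0 : 0 ≤ LV := mul_nonneg hsβ.le (add_nonneg hCδ0 hsum0)
  have hsqle : ∀ q : ↥S, Real.sqrt (K * CW q) ≤ ∑ p ∈ S, Real.sqrt (K * CW p) := fun q =>
    Finset.single_le_sum (f := fun p => Real.sqrt (K * CW p)) (fun p _ => Real.sqrt_nonneg _) q.2
  have hYd : ∀ U (q : ↥S) a, |Real.sqrt β * (σ * (if a = b then dδ q else 0) + err U q a)| ≤
      Real.sqrt β * (Cδ + Real.sqrt (K * CW q)) := fun U q a => by
    rw [abs_mul, abs_of_pos hsβ]
    refine mul_le_mul_of_nonneg_left ((abs_add_le _ _).trans (add_le_add ?_ (herrb U q a))) hsβ.le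
    rw [abs_mul, hσabs, one_mul]
    split_ifs
    · exact hCδ q
    · simpa using hCδ0
  have hYd' : ∀ U (q : ↥S) a, |Real.sqrt β * (σ * (if a = b then dδ q else 0) + err U q a)| ≤ LV := fun U q a =>
    (hYd U q a).trans (mul_le_mul_of_nonneg_left (add_le_add le_rfl (hsqle q)) hsβ.le)
  have hVSb : ∀ U, ‖VS U‖ ≤ LV := fun U => by
    refine (pi_norm_le_iff_of_nonneg hLV0).2 fun q => (pi_norm_le_iff_of_nonneg hLV0).2 fun a => ?_
    rw [Real.norm_eq_abs]
    exact hYd' U q a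
  -- Lipschitz bound for the block field along the flow
  have hYlip : ∀ (q : ↥S) a U t s, |Y (T t U) q a - Y (T s U) q a| ≤ LV * |t - s| := fun q a U t s =>
    lipschitz_of_flow T hflow (fun U => Y U q a) _ (fun U => (herr U q a).1) (fun U => hYd' U q a) U t s
  have hYSlip : ∀ U t s, ‖YS (T t U) - YS (T s U)‖ ≤ LV * |t - s| := fun U t s => by
    have h0 : 0 ≤ LV * |t - s| := mul_nonneg hLV0 (abs_nonneg _)
    refine (pi_norm_le_iff_of_nonneg h0).2 fun q => (pi_norm_le_iff_of_nonneg h0).2 fun a => ?_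
    rw [Pi.sub_apply, Pi.sub_apply, Real.norm_eq_abs]
    exact hYlip q a U t s
  -- the test observable along the flow is Lipschitz
  have hglip : ∀ y y', |g y - g y'| ≤ M * ‖y - y'‖ := abs_sub_le_of_fderiv_le hM hg hgM
  have hAlip : ∀ (U : X) (t s : ℝ), |g (YS (T t U)) - g (YS (T s U))| ≤ M * LV * |t - s| := fun U t s =>
    (hglip _ _).trans (by rw [mul_assoc]; exact mul_le_mul_of_nonneg_left (hYSlip U t s) hM)
  -- bound on the action derivative and Lipschitz bound for the action along the flow
  obtain ⟨LD, hLD0, hDb⟩ : ∃ LD : ℝ, 0 ≤ LD ∧ ∀ U, |D U| ≤ LD := by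
    refine ⟨((∑ q ∈ Pe, Cδ * CY q) + K * Real.sqrt β * ∑ q ∈ Pe, CW q) / Real.sqrt β, ?_, fun U => ?_⟩
    · refine div_nonneg (add_nonneg (Finset.sum_nonneg fun q _ => mul_nonneg hCδ0 (hCY0 q)) ?_) hsβ.le
      exact mul_nonneg (mul_nonneg hK hsβ.le) (Finset.sum_nonneg fun q _ => hCW0 q)
    · have h1 := (hDer U).2
      have h2 : |σ * ∑ q ∈ Pe, dδ q * Y U q b| ≤ ∑ q ∈ Pe, Cδ * CY q := by
        rw [abs_mul, hσabs, one_mul]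
        refine (Finset.abs_sum_le_sum_abs _ _).trans (Finset.sum_le_sum fun q _ => ?_)
        rw [abs_mul]
        exact mul_le_mul (hCδ q) (hCY q U) (abs_nonneg _) hCδ0
      have h3 : K * Real.sqrt β * ∑ q ∈ Pe, W U q ≤ K * Real.sqrt β * ∑ q ∈ Pe, CW q :=
        mul_le_mul_of_nonneg_left (Finset.sum_le_sum fun q _ => (le_abs_self _).trans (hCW q U)) (mul_nonneg hK hsβ.le)
      have h4 : |Real.sqrt β * D U| ≤ (∑ q ∈ Pe, Cδ * CY q) + K * Real.sqrt β * ∑ q ∈ Pe, CW q := by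
        have := abs_sub_abs_le_abs_sub (Real.sqrt β * D U) (σ * ∑ q ∈ Pe, dδ q * Y U q b)
        linarith
      rw [le_div_iff₀ hsβ, mul_comm]
      rwa [abs_mul, abs_of_pos hsβ] at h4
  have hSlip : ∀ U t s, |Se (T t U) - Se (T s U)| ≤ LD * |t - s| :=
    lipschitz_of_flow T hflow Se D (fun U => (hDer U).1) hDb
  -- the exponent `-β (Se(T_{-t} U) - Se U)`: bounded above and Lipschitz
  have hexpM : ∀ U t, -(β * (Se (T (-t) U) - Se U)) ≤ 2 * β * CS := fun U t => by
    have h1 := hCS (T (-t) U); have h2 := hCS U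
    rw [abs_le] at h1 h2
    nlinarith
  have hexplip : ∀ U t s, |-(β * (Se (T (-t) U) - Se U)) - -(β * (Se (T (-s) U) - Se U))| ≤ β * LD * |t - s| :=
    fun U t s => by
    have := hSlip U (-t) (-s)
    rw [show -(β * (Se (T (-t) U) - Se U)) - -(β * (Se (T (-s) U) - Se U)) =
      -(β * (Se (T (-t) U) - Se (T (-s) U))) by ring, abs_neg, abs_mul, abs_of_pos hβ, mul_assoc]
    refine mul_le_mul_of_nonneg_left (this.trans_eq ?_) hβ.le
    rw [show -t - -s = -(t - s) by ring, abs_neg]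
  -- the constant for `stub_diffIdentity`
  have hexp0 : 0 ≤ Real.exp (2 * β * CS) := (Real.exp_pos _).le
  obtain ⟨K5, hK5a, hK5b, hK5c, hK5d⟩ : ∃ K5 : ℝ, 1 ≤ K5 ∧ Real.exp (2 * β * CS) ≤ K5 ∧ M * LV ≤ K5 ∧
      Real.exp (2 * β * CS) * (β * LD) ≤ K5 := by
    have hprod0 : 0 ≤ Real.exp (2 * β * CS) * (β * LD) := mul_nonneg hexp0 (mul_nonneg hβ.le hLD0)
    have hML : 0 ≤ M * LV := mul_nonneg hM hLV0
    exact ⟨1 + Real.exp (2 * β * CS) + M * LV + Real.exp (2 * β * CS) * (β * LD), by linarith, by linarith,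
      by linarith, by linarith⟩
  -- the two families `A t U = g(YS(T_t U))`, `B t U = g(YS U) exp(…)`
  have hAbd : ∀ (t : ℝ) (U : X), |g (YS (T t U))| ≤ K5 := fun t U => (hgb _).trans hK5a
  have hBbd : ∀ (t : ℝ) (U : X), |g (YS U) * Real.exp (-(β * (Se (T (-t) U) - Se U)))| ≤ K5 := fun t U => by
    rw [abs_mul, Real.abs_exp]
    have : |g (YS U)| * Real.exp (-(β * (Se (T (-t) U) - Se U))) ≤ 1 * Real.exp (2 * β * CS) :=
      mul_le_mul (hgb _) (Real.exp_le_exp.2 (hexpM U t)) (Real.exp_pos _).le zero_le_one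
    linarith
  have hAlip' : ∀ (U : X) (t s : ℝ), |g (YS (T t U)) - g (YS (T s U))| ≤ K5 * |t - s| := fun U t s =>
    (hAlip U t s).trans (mul_le_mul_of_nonneg_right hK5c (abs_nonneg _))
  have hBlip : ∀ (U : X) (t s : ℝ), |g (YS U) * Real.exp (-(β * (Se (T (-t) U) - Se U))) -
      g (YS U) * Real.exp (-(β * (Se (T (-s) U) - Se U)))| ≤ K5 * |t - s| := fun U t s => by
    rw [← mul_sub, abs_mul]
    have h1 : |Real.exp (-(β * (Se (T (-t) U) - Se U))) - Real.exp (-(β * (Se (T (-s) U) - Se U)))| ≤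
        Real.exp (2 * β * CS) * (β * LD * |t - s|) :=
      (abs_exp_sub_exp_le (hexpM U t) (hexpM U s)).trans (mul_le_mul_of_nonneg_left (hexplip U t s) hexp0)
    have h2 := mul_le_mul (hgb (YS U)) h1 (abs_nonneg _) zero_le_one
    refine h2.trans ?_
    rw [one_mul, ← mul_assoc]
    exact mul_le_mul_of_nonneg_right hK5d (abs_nonneg _)
  -- measurability
  have hAm : ∀ t : ℝ, Measurable fun U => g (YS (T t U)) := fun t => (hgc.comp (hYSc.comp (hTt t))).measurable
  have hexpc : Continuous fun q : ℝ × X => -(β * (Se (T (-q.1) q.2) - Se q.2)) := by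
    have h1 : Continuous fun q : ℝ × X => Se (T (-q.1) q.2) :=
      hSec.comp (hTc.comp ((continuous_neg.comp continuous_fst).prodMk continuous_snd))
    exact (continuous_const.mul (h1.sub (hSec.comp continuous_snd))).neg
  have hBm : ∀ t : ℝ, Measurable fun U => g (YS U) * Real.exp (-(β * (Se (T (-t) U) - Se U))) := fun t =>
    ((hgc.comp hYSc).mul (Real.continuous_exp.comp (hexpc.comp (continuous_const.prodMk continuous_id)))).measurable
  have ham : Measurable fun U => deriv (fun t => g (YS (T t U))) 0 :=
    measurable_deriv_param (fun t U => g (YS (T t U))) (hgc.comp hYSTc)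
  have hbm : Measurable fun U => deriv (fun t => g (YS U) * Real.exp (-(β * (Se (T (-t) U) - Se U)))) 0 :=
    measurable_deriv_param (fun t U => g (YS U) * Real.exp (-(β * (Se (T (-t) U) - Se U))))
      (((hgc.comp hYSc).comp continuous_snd).mul (Real.continuous_exp.comp hexpc))
  -- derivatives at 0: the chain rule through `fderiv`
  have hcurve : ∀ U, HasDerivAt (fun t => YS (T t U)) (VS U) 0 := fun U =>
    hasDerivAt_pi.2 fun q => hasDerivAt_pi.2 fun a => (herr U q a).1
  have hA0 : ∀ U, HasDerivAt (fun t => g (YS (T t U))) (fderiv ℝ g (YS U) (VS U)) 0 := by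
    intro U
    have hdg : HasFDerivAt g (fderiv ℝ g (YS (T 0 U))) (YS (T 0 U)) :=
      ((hg.differentiable one_ne_zero) _).hasFDerivAt
    have := hdg.comp_hasDerivAt (0 : ℝ) (hcurve U)
    rw [hT0] at this
    exact this
  have hB0 : ∀ U, HasDerivAt (fun t => g (YS U) * Real.exp (-(β * (Se (T (-t) U) - Se U)))) (g (YS U) * (β * D U)) 0 := by
    intro U
    have h1 : HasDerivAt (fun t => Se (T t U)) (D U) (-0) := by
      rw [neg_zero]
      have := hasDerivAt_of_flow T hflow Se D (fun U => (hDer U).1) 0 U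
      rwa [hT0] at this
    have h2 : HasDerivAt (fun t => Se (T (-t) U)) (-(D U)) 0 := by
      have := h1.scomp 0 (hasDerivAt_neg 0)
      rw [smul_eq_mul, neg_one_mul] at this
      exact this
    have h3 : HasDerivAt (fun t => -(β * (Se (T (-t) U) - Se U))) (β * D U) 0 :=
      ((h2.sub_const (Se U)).const_mul β).neg.congr_deriv (by ring)
    have h4 := (h3.exp).const_mul (g (YS U))
    have hg0 : -(β * (Se (T (-0) U) - Se U)) = 0 := by rw [neg_zero, hT0, sub_self, mul_zero, neg_zero]
    rw [hg0, Real.exp_zero, one_mul] at h4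
    exact h4
  -- differentiate under the integral sign (tree `stub_diffIdentity`)
  have hdiff := stub_diffIdentity X μ inferInstance (fun t U => g (YS (T t U)))
    (fun t U => g (YS U) * Real.exp (-(β * (Se (T (-t) U) - Se U))))
    (fun U => deriv (fun t => g (YS (T t U))) 0)
    (fun U => deriv (fun t => g (YS U) * Real.exp (-(β * (Se (T (-t) U) - Se U)))) 0) K5 hAm hBm ham hbm hAbd hBbd
    hAlip' hBlip (fun U => (hA0 U).differentiableAt.hasDerivAt) (fun U => (hB0 U).differentiableAt.hasDerivAt) hHaar
  have ha' : (fun U => deriv (fun t => g (YS (T t U))) 0) = fun U => fderiv ℝ g (YS U) (VS U) :=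
    funext fun U => (hA0 U).deriv
  have hb' : (fun U => deriv (fun t => g (YS U) * Real.exp (-(β * (Se (T (-t) U) - Se U)))) 0) =
      fun U => g (YS U) * (β * D U) := funext fun U => (hB0 U).deriv
  rw [ha', hb'] at hdiff
  -- hdiff : ∫ fderiv g (YS U) (VS U) = ∫ g(YS U) * (β * D U)
  -- integrability of the players
  have hEc : ∀ p : ↥S, Continuous fun U => fderiv ℝ g (YS U) (E p) := fun p =>
    (hfdc.comp hYSc).clm_apply continuous_const
  have hEb : ∀ (p : ↥S) U, |fderiv ℝ g (YS U) (E p)| ≤ M := fun p U => by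
    refine (abs_clm_apply_le _ (hgM _) _).trans ?_
    have hE1 : ‖E p‖ ≤ 1 := by
      refine (pi_norm_le_iff_of_nonneg zero_le_one).2 fun q => (pi_norm_le_iff_of_nonneg zero_le_one).2 fun a => ?_
      simp only [hE, Real.norm_eq_abs]
      split_ifs <;> simp
    nlinarith [norm_nonneg (E p)]
  have hEint : ∀ p : ↥S, Integrable (fun U => fderiv ℝ g (YS U) (E p)) μ := fun p =>
    Integrable.of_bound (hEc p).measurable.aestronglyMeasurable M
      (ae_of_all _ fun U => by rw [Real.norm_eq_abs]; exact hEb p U)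
  -- integrability of the two derivatives
  have haint : Integrable (fun U => fderiv ℝ g (YS U) (VS U)) μ := by
    refine Integrable.of_bound (ha' ▸ ham).aestronglyMeasurable (M * LV) (ae_of_all _ fun U => ?_)
    rw [Real.norm_eq_abs]
    exact (abs_clm_apply_le _ (hgM _) _).trans (mul_le_mul_of_nonneg_left (hVSb U) hM)
  have hbint : Integrable (fun U => g (YS U) * (β * D U)) μ := by
    refine Integrable.of_bound (hb' ▸ hbm).aestronglyMeasurable (1 * (β * LD)) (ae_of_all _ fun U => ?_)
    rw [Real.norm_eq_abs, abs_mul, abs_mul, abs_of_pos hβ]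
    exact mul_le_mul (hgb _) (mul_le_mul_of_nonneg_left (hDb U) hβ.le) (mul_nonneg hβ.le (abs_nonneg _)) zero_le_one
  obtain ⟨Cℓ, -, hCℓ⟩ := exists_abs_le_of_continuous hℓc
  have hgℓint : Integrable (fun U => g (YS U) * ℓ U) μ :=
    Integrable.of_bound ((hgc.comp hYSc).mul hℓc).measurable.aestronglyMeasurable (1 * Cℓ)
      (ae_of_all _ fun U => by rw [Real.norm_eq_abs, abs_mul]; exact mul_le_mul (hgb _) (hCℓ U) (abs_nonneg _) zero_le_one)
  -- the paired partial derivatives `κg U = ∑_p dδ_p ∂_{(p,b)} g (YS U)`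
  set κg : X → ℝ := fun U => ∑ p : ↥S, dδ p * fderiv ℝ g (YS U) (E p) with hκg
  have hκint : Integrable κg μ := integrable_finsetSum _ fun p _ => (hEint p).const_mul _
  -- linear algebra of the velocity: `VS U = √β • (σ • ∑_p dδ_p • E p + ErrS U)`
  have hBsum : ∀ (q : ↥S) (a : Fin Dc),
      (∑ p : ↥S, if q = p ∧ a = b then dδ p else 0) = if a = b then dδ q else 0 := by
    intro q a
    by_cases hab : a = b
    · simp only [hab, and_true, if_true]
      rw [Finset.sum_ite_eq Finset.univ q (fun p : ↥S => dδ p), if_pos (Finset.mem_univ q)]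
    · simp [hab]
  have hVSdec : ∀ U, VS U = Real.sqrt β • (σ • ∑ p : ↥S, dδ p • E p + ErrS U) := by
    intro U
    funext q a
    simp only [hVS, hErrS, hE, Pi.smul_apply, Pi.add_apply, Finset.sum_apply, smul_eq_mul, mul_ite, mul_one,
      mul_zero, hBsum]
  have hfd : ∀ U, fderiv ℝ g (YS U) (VS U) = Real.sqrt β * (σ * κg U + fderiv ℝ g (YS U) (ErrS U)) := by
    intro U
    rw [hVSdec U]
    simp only [hκg, map_smul, map_add, map_sum, smul_eq_mul]
  -- the pointwise bound on the error block
  have hErrb : ∀ U, ‖ErrS U‖ ≤ θ / 2 + K * (∑ p ∈ S, W U p) / (2 * θ) := by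
    intro U
    have hS0 : 0 ≤ ∑ p ∈ S, W U p := Finset.sum_nonneg fun p _ => hW0 U p
    have h0 : 0 ≤ θ / 2 + K * (∑ p ∈ S, W U p) / (2 * θ) := by positivity
    refine (pi_norm_le_iff_of_nonneg h0).2 fun q => (pi_norm_le_iff_of_nonneg h0).2 fun a => ?_
    rw [Real.norm_eq_abs]
    have h1 : W U q ≤ ∑ p ∈ S, W U p := Finset.single_le_sum (f := fun p => W U p) (fun p _ => hW0 U p) q.2
    calc |err U q a| ≤ θ / 2 + (err U q a) ^ 2 / (2 * θ) := abs_le_amgm hθ _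
      _ ≤ θ / 2 + K * W U q / (2 * θ) := by
          refine add_le_add le_rfl (div_le_div_of_nonneg_right (herr U q a).2 (by positivity))
      _ ≤ θ / 2 + K * (∑ p ∈ S, W U p) / (2 * θ) := by
          refine add_le_add le_rfl (div_le_div_of_nonneg_right (mul_le_mul_of_nonneg_left h1 hK) (by positivity))
  -- the two remainders, pointwise
  have hrem1 : ∀ U, |fderiv ℝ g (YS U) (VS U) / Real.sqrt β - σ * κg U| ≤
      M * (θ / 2 + K * (∑ p ∈ S, W U p) / (2 * θ)) := fun U => by
    rw [hfd U, show Real.sqrt β * (σ * κg U + fderiv ℝ g (YS U) (ErrS U)) / Real.sqrt β - σ * κg U =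
      fderiv ℝ g (YS U) (ErrS U) by field_simp; ring]
    exact (abs_clm_apply_le _ (hgM _) _).trans (mul_le_mul_of_nonneg_left (hErrb U) hM)
  have hℓPe : ∀ U, ℓ U = ∑ q ∈ Pe, dδ q * Y U q b := fun U => by
    rw [hℓ]
    exact (Finset.sum_subset hPS fun p hpS hpPe => by rw [hδ0 p hpS hpPe, zero_mul]).symm
  have hrem2 : ∀ U, |g (YS U) * (β * D U) / Real.sqrt β - σ * (g (YS U) * ℓ U)| ≤ K * Real.sqrt β * ∑ q ∈ Pe, W U q :=
    fun U => by
    have hβs : β / Real.sqrt β = Real.sqrt β := Real.div_sqrt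
    rw [show g (YS U) * (β * D U) / Real.sqrt β - σ * (g (YS U) * ℓ U) =
      g (YS U) * (β / Real.sqrt β * D U - σ * ℓ U) by ring, hβs, hℓPe U, abs_mul]
    exact (mul_le_of_le_one_left (abs_nonneg _) (hgb _)).trans (hDer U).2
  -- integrability of the bounds
  have hWSc : Continuous fun U => ∑ p ∈ S, W U p := continuous_finsetSum _ fun p _ => hWc p
  obtain ⟨CWS, -, hCWS⟩ := exists_abs_le_of_continuous hWSc
  have hWSint : Integrable (fun U => ∑ p ∈ S, W U p) μ :=
    Integrable.of_bound hWSc.measurable.aestronglyMeasurable CWS (ae_of_all _ fun U => by rw [Real.norm_eq_abs]; exact hCWS U)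
  have hΦint : Integrable (fun U => M * (θ / 2 + K * (∑ p ∈ S, W U p) / (2 * θ))) μ :=
    ((integrable_const _).add ((hWSint.const_mul K).div_const _)).const_mul M
  have hSWc : Continuous fun U => K * Real.sqrt β * ∑ q ∈ Pe, W U q :=
    continuous_const.mul (continuous_finsetSum _ fun q _ => hWc q)
  obtain ⟨CSW, -, hCSW⟩ := exists_abs_le_of_continuous hSWc
  have hSWint : Integrable (fun U => K * Real.sqrt β * ∑ q ∈ Pe, W U q) μ :=
    Integrable.of_bound hSWc.measurable.aestronglyMeasurable CSW (ae_of_all _ fun U => by rw [Real.norm_eq_abs]; exact hCSW U)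
  -- the integrals of the remainders
  have hI1 : ∫ U, (fderiv ℝ g (YS U) (VS U) / Real.sqrt β - σ * κg U) ∂μ =
      (∫ U, fderiv ℝ g (YS U) (VS U) ∂μ) / Real.sqrt β - σ * ∫ U, κg U ∂μ := by
    rw [integral_sub (haint.div_const _) (hκint.const_mul _), integral_div, integral_const_mul]
  have hI2 : ∫ U, (g (YS U) * (β * D U) / Real.sqrt β - σ * (g (YS U) * ℓ U)) ∂μ =
      (∫ U, g (YS U) * (β * D U) ∂μ) / Real.sqrt β - σ * ∫ U, g (YS U) * ℓ U ∂μ := by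
    rw [integral_sub (hbint.div_const _) (hgℓint.const_mul _), integral_div, integral_const_mul]
  have hΦval : ∫ U, M * (θ / 2 + K * (∑ p ∈ S, W U p) / (2 * θ)) ∂μ =
      M * (θ / 2 + K * (∫ U, ∑ p ∈ S, W U p ∂μ) / (2 * θ)) := by
    rw [integral_const_mul, integral_add (integrable_const _) ((hWSint.const_mul K).div_const _), integral_const,
      integral_div, integral_const_mul]
    simp
  have hB1 := norm_integral_le_of_norm_le hΦint (ae_of_all _ fun U => by
    rw [Real.norm_eq_abs]; exact hrem1 U)
  have hB2 := norm_integral_le_of_norm_le hSWint (ae_of_all _ fun U => by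
    rw [Real.norm_eq_abs]; exact hrem2 U)
  rw [Real.norm_eq_abs, hI1, hΦval] at hB1
  rw [Real.norm_eq_abs, hI2, integral_const_mul] at hB2
  -- conclusion
  have hmain : (∑ p : ↥S, dδ p * ∫ U, fderiv ℝ g (YS U) (E p) ∂μ) = ∫ U, κg U ∂μ := by
    rw [hκg, integral_finsetSum _ fun p _ => (hEint p).const_mul _]
    exact Finset.sum_congr rfl fun p _ => (integral_const_mul _ _).symm
  have hkey : σ * ((∫ U, κg U ∂μ) - ∫ U, g (YS U) * ℓ U ∂μ) =
      ((∫ U, g (YS U) * (β * D U) ∂μ) / Real.sqrt β - σ * ∫ U, g (YS U) * ℓ U ∂μ) -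
        ((∫ U, fderiv ℝ g (YS U) (VS U) ∂μ) / Real.sqrt β - σ * ∫ U, κg U ∂μ) := by
    rw [hdiff]; ring
  have habs : |(∫ U, κg U ∂μ) - ∫ U, g (YS U) * ℓ U ∂μ| =
      |σ * ((∫ U, κg U ∂μ) - ∫ U, g (YS U) * ℓ U ∂μ)| := by rw [abs_mul, hσabs, one_mul]
  have hfinal : |(∫ U, κg U ∂μ) - ∫ U, g (YS U) * ℓ U ∂μ| ≤
      M * (θ / 2 + K * (∫ U, ∑ p ∈ S, W U p ∂μ) / (2 * θ)) + K * Real.sqrt β * ∫ U, ∑ q ∈ Pe, W U q ∂μ := by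
    rw [habs, hkey]
    exact (abs_sub _ _).trans (by linarith)
  rw [hmain]
  exact hfinal

end Core

end SdRate

end Summit.QuantumFields.YangMills.Cruxes.FreeProbeLawG.SteinFree

end
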